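import Mathlib
import Summits.Ventures.PercRepro2.CoinKSureAD
import Summits.Ventures.PercRepro2.CoinChainMixLsm
import Summits.Ventures.PercRepro2.CoinChainWorld1
import Summits.Ventures.PercRepro2.CoinChainStar
import Summits.Ventures.PercRepro2.CoinChainMixedCentreChain
import Summits.Ventures.PercRepro2.CoinChainBernstein
import Summits.Ventures.PercRepro2.CoinChainOneMarker

/-!
# The Bernstein coefficient `b₂` of the pure chain from (Q′), and the pure chain from `b₂` alone
(blind cell PercRepro2, night-2 g22; proofs/NIGHT2-DARC.md §62.5, §62.9)

Pure chain (`ent = ∅`): world-0 law `ν·c` (moments `a0 a1 a2 a12`), world-1 `R`-law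
`ν·chainMix ∅ ent' 1 c d` (moments `b0 b1 b2`), world-1 gate `ν·chainMix ∅ ent' 1 c d'` (moments
`g0 g1 g2 g12`), ideal mass `m = ∑_I ν c` and ideal moments `xI, yI`.  The census-true,
nearly tight inequality of §62.9 is, for the `x`-orientation,

  (Q*ₓ)  `(a0 b1 − b0 a1) · (m b2 − b0 yI) ≤ a0 · U111`,   `U111 = T(R¹, G¹)`,

i.e. `T(R¹,G¹) ≥ Λ₁² m_I (p₁ − p₀)(q₁ − q_I)`, and (Q*ᵧ) its mirror.  THEOREM
(`pureChain_functional_nonneg_of_Qstar`): under the head hypotheses of `chain_world1_nonneg`,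
positive world masses and a positive ideal mass, (Q*ₓ) and (Q*ᵧ) imply the pure chain functional
`T(R_ρ, G_ρ) ≥ 0` at EVERY `ρ ∈ [0, 1]` for every pair of nonnegative increasing markers.

Proof: (Q*) + the one-marker bound (`one_marker_bound`, in the global form
`(b0 − g0)(b0 a2 − a0 b2) ≤ a0 (m b2 − b0 yI)`) give (Q′) `a0²·U111 + (b0 − g0)·Δ ≥ 0`
(`Qprime_of_Qstar_alg`, a sign case analysis); (Q′) with FKG of the world-0 law and the
mixed-centre term `U001` gives the Bernstein coefficient `U110 + U101 + U011 ≥ 0` through the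
identity `a0 b0 (U110 + U101 + U011) = b0³ D₀ + b0² U001 + a0² U111 + (b0 − g0) Δ`
(`b2_star_identity` — the ρ²(1−ρ) coefficient of §58's (★)); the other three Bernstein
coefficients are FKG, `U001`, `U111` (`chain_world1_mixed_nonneg`) and `chain_bernstein_nonneg`
closes.  So the universal pure chain is REDUCED to (Q*) — the statement of record of §62.9.
-/

namespace Summit.Ventures.PercRepro2.Coin

open Classical

section QstarAlgebra

variable {R : Type*} [Field R] [LinearOrder R] [IsStrictOrderedRing R]

omit [LinearOrder R] [IsStrictOrderedRing R] in
/-- The `ρ²(1−ρ)` coefficient of (★): `a0 b0 (U110 + U101 + U011) = b0³ D₀ + b0² U001 + a0² U111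
+ (b0 − g0) Δ`. -/
lemma b2_star_identity (a0 a1 a2 a12 b0 b1 b2 g0 g1 g2 g12 : R) :
    a0 * b0 * ((b0 * b0 * a12 - b0 * b2 * a1 - b0 * b1 * a2 + b1 * b2 * a0)
        + (b0 * a0 * g12 - b0 * a2 * g1 - a0 * b1 * g2 + b1 * a2 * g0)
        + (a0 * b0 * g12 - a0 * b2 * g1 - b0 * a1 * g2 + a1 * b2 * g0)) =
      b0 ^ 3 * (a0 * a12 - a1 * a2)
        + b0 ^ 2 * (a0 * a0 * g12 - a0 * a2 * g1 - a0 * a1 * g2 + a1 * a2 * g0)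
        + a0 ^ 2 * (b0 * b0 * g12 - b0 * b2 * g1 - b0 * b1 * g2 + b1 * b2 * g0)
        + (b0 - g0) * ((b0 * a1 - a0 * b1) * (b0 * a2 - a0 * b2)) := by
  ring

/-- (Q′) ⟹ the second Bernstein coefficient is nonnegative (positive world masses). -/
lemma b2_of_Qprime (a0 a1 a2 a12 b0 b1 b2 g0 g1 g2 g12 : R) (ha0 : 0 < a0) (hb0 : 0 < b0)
    (hD : 0 ≤ a0 * a12 - a1 * a2)
    (hT01 : 0 ≤ a0 * a0 * g12 - a0 * a2 * g1 - a0 * a1 * g2 + a1 * a2 * g0)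
    (hQ : 0 ≤ a0 ^ 2 * (b0 * b0 * g12 - b0 * b2 * g1 - b0 * b1 * g2 + b1 * b2 * g0)
        + (b0 - g0) * ((b0 * a1 - a0 * b1) * (b0 * a2 - a0 * b2))) :
    0 ≤ (b0 * b0 * a12 - b0 * b2 * a1 - b0 * b1 * a2 + b1 * b2 * a0)
        + (b0 * a0 * g12 - b0 * a2 * g1 - a0 * b1 * g2 + b1 * a2 * g0)
        + (a0 * b0 * g12 - a0 * b2 * g1 - b0 * a1 * g2 + a1 * b2 * g0) := by
  have key := b2_star_identity a0 a1 a2 a12 b0 b1 b2 g0 g1 g2 g12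
  have h1 : 0 ≤ b0 ^ 3 * (a0 * a12 - a1 * a2) := mul_nonneg (pow_nonneg hb0.le 3) hD
  have h2 : 0 ≤ b0 ^ 2 * (a0 * a0 * g12 - a0 * a2 * g1 - a0 * a1 * g2 + a1 * a2 * g0) :=
    mul_nonneg (pow_nonneg hb0.le 2) hT01
  have hprod : 0 ≤ a0 * b0 * ((b0 * b0 * a12 - b0 * b2 * a1 - b0 * b1 * a2 + b1 * b2 * a0)
        + (b0 * a0 * g12 - b0 * a2 * g1 - a0 * b1 * g2 + b1 * a2 * g0)
        + (a0 * b0 * g12 - a0 * b2 * g1 - b0 * a1 * g2 + a1 * b2 * g0)) := by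
    rw [key]; linarith
  exact nonneg_of_mul_nonneg_right hprod (mul_pos ha0 hb0) |> fun h => by
    -- `nonneg_of_mul_nonneg_right : 0 ≤ a * b → 0 < a → 0 ≤ b`
    exact h

/-- (Q*) in both orientations and the one-marker bound in both orientations give (Q′):
`a0² U111 + (b0 − g0) Δ ≥ 0`, by the sign of the two world shifts. -/
lemma Qprime_of_Qstar_alg (a0 a1 a2 b0 b1 b2 g0 m xI yI U : R) (ha0 : 0 ≤ a0) (hU : 0 ≤ U)
    (hP : 0 ≤ b0 - g0)
    (hQx : (a0 * b1 - b0 * a1) * (m * b2 - b0 * yI) ≤ a0 * U)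
    (hQy : (a0 * b2 - b0 * a2) * (m * b1 - b0 * xI) ≤ a0 * U)
    (hOMx : (b0 - g0) * (b0 * a1 - a0 * b1) ≤ a0 * (m * b1 - b0 * xI))
    (hOMy : (b0 - g0) * (b0 * a2 - a0 * b2) ≤ a0 * (m * b2 - b0 * yI)) :
    0 ≤ a0 ^ 2 * U + (b0 - g0) * ((b0 * a1 - a0 * b1) * (b0 * a2 - a0 * b2)) := by
  set E := a0 * b1 - b0 * a1 with hE
  set F := a0 * b2 - b0 * a2 with hF
  have hΔ : (b0 * a1 - a0 * b1) * (b0 * a2 - a0 * b2) = E * F := by rw [hE, hF]; ring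
  rw [hΔ]
  have ha2 : 0 ≤ a0 ^ 2 * U := mul_nonneg (pow_nonneg ha0 2) hU
  by_cases hEF : 0 ≤ E * F
  · exact add_nonneg ha2 (mul_nonneg hP hEF)
  · have hEF' : E * F < 0 := not_le.mp hEF
    by_cases hE0 : 0 ≤ E
    · -- E ≥ 0, hence F < 0: (Q*ₓ) and (OM)ᵧ
      have hF0 : F < 0 := by
        by_contra hF0
        have hF0' : 0 ≤ F := not_lt.mp hF0
        exact hEF (mul_nonneg hE0 hF0')
      -- (OM)ᵧ: (b0 − g0)(−F) ≤ a0 (m b2 − b0 yI)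
      have hOM' : (b0 - g0) * (-F) ≤ a0 * (m * b2 - b0 * yI) := by
        have : b0 * a2 - a0 * b2 = -F := by rw [hF]; ring
        rw [← this]; exact hOMy
      -- multiply by E ≥ 0 and chain with (Q*ₓ) times a0
      have h1 : E * ((b0 - g0) * (-F)) ≤ E * (a0 * (m * b2 - b0 * yI)) :=
        mul_le_mul_of_nonneg_left hOM' hE0
      have h2 : a0 * (E * (m * b2 - b0 * yI)) ≤ a0 * (a0 * U) :=
        mul_le_mul_of_nonneg_left hQx ha0
      nlinarith [h1, h2]
    · -- E < 0, hence F > 0: (Q*ᵧ) and (OM)ₓ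
      have hE' : E < 0 := not_le.mp hE0
      have hF0 : 0 < F := by
        by_contra hF0
        have hF0' : F ≤ 0 := not_lt.mp hF0
        exact hEF (mul_nonneg_of_nonpos_of_nonpos hE'.le hF0')
      have hOM' : (b0 - g0) * (-E) ≤ a0 * (m * b1 - b0 * xI) := by
        have : b0 * a1 - a0 * b1 = -E := by rw [hE]; ring
        rw [← this]; exact hOMx
      have h1 : F * ((b0 - g0) * (-E)) ≤ F * (a0 * (m * b1 - b0 * xI)) :=
        mul_le_mul_of_nonneg_left hOM' hF0.le
      have h2 : a0 * (F * (m * b1 - b0 * xI)) ≤ a0 * (a0 * U) :=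
        mul_le_mul_of_nonneg_left hQy ha0
      nlinarith [h1, h2]

end QstarAlgebra

section QstarChain

variable {V : Type*} [DecidableEq V] {R : Type*} [Field R] [LinearOrder R] [IsStrictOrderedRing R]

set_option maxHeartbeats 400000 in
/-- The PURE chain at every `ρ` from the second Bernstein coefficient alone (general markers):
`hb2 : 0 ≤ U(1,1,0) + U(1,0,1) + U(0,1,1)` with world 0 written as `ν · c`. -/
theorem pureChain_functional_nonneg_of_b2 (U ent' : Finset V) (ν c d d' : Finset V → R)
    (ρ : R) (hρ0 : 0 ≤ ρ) (hρ1 : ρ ≤ 1) (hν0 : ∀ W, 0 ≤ ν W)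
    (hν : ∀ s ⊆ U, ∀ t ⊆ U, ν s * ν t ≤ ν (s ∩ t) * ν (s ∪ t))
    (hc0 : ∀ W, 0 ≤ c W) (hd0 : ∀ W, 0 ≤ d W) (hd'0 : ∀ W, 0 ≤ d' W)
    (hdc : ∀ W, d W ≤ c W) (hd'c : ∀ W, d' W ≤ c W)
    (hcc : ∀ s t, c s * c t ≤ c (s ∩ t) * c (s ∪ t))
    (hdd : ∀ s t, d s * d t ≤ d (s ∩ t) * d (s ∪ t))
    (hd'd' : ∀ s t, d' s * d' t ≤ d' (s ∩ t) * d' (s ∪ t))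
    (hcd : ∀ s t, c s * d t ≤ c (s ∩ t) * d (s ∪ t))
    (hcd' : ∀ s t, c s * d' t ≤ c (s ∩ t) * d' (s ∪ t))
    (hdd' : ∀ s t, d s * d' t ≤ d (s ∩ t) * d' (s ∪ t))
    (hratio : ∀ s t, s ⊆ t → d s * c t ≤ c s * d t)
    (hratio' : ∀ s t, s ⊆ t → d' s * c t ≤ c s * d' t)
    (x y : Finset V → R) (hx0 : ∀ W, 0 ≤ x W) (hy0 : ∀ W, 0 ≤ y W)
    (hxm : ∀ s t, x s ≤ x (s ∪ t)) (hym : ∀ s t, y s ≤ y (s ∪ t))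
    (hb2 : 0 ≤ ((∑ W ∈ U.powerset, ν W * chainMix ∅ ent' 1 c d W) *
          (∑ W ∈ U.powerset, ν W * chainMix ∅ ent' 1 c d W) *
          (∑ W ∈ U.powerset, ν W * c W * (x W * y W))
        - (∑ W ∈ U.powerset, ν W * chainMix ∅ ent' 1 c d W) *
          (∑ W ∈ U.powerset, ν W * chainMix ∅ ent' 1 c d W * y W) *
          (∑ W ∈ U.powerset, ν W * c W * x W)
        - (∑ W ∈ U.powerset, ν W * chainMix ∅ ent' 1 c d W) *
          (∑ W ∈ U.powerset, ν W * chainMix ∅ ent' 1 c d W * x W) *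
          (∑ W ∈ U.powerset, ν W * c W * y W)
        + (∑ W ∈ U.powerset, ν W * chainMix ∅ ent' 1 c d W * x W) *
          (∑ W ∈ U.powerset, ν W * chainMix ∅ ent' 1 c d W * y W) *
          (∑ W ∈ U.powerset, ν W * c W))
        + ((∑ W ∈ U.powerset, ν W * chainMix ∅ ent' 1 c d W) *
          (∑ W ∈ U.powerset, ν W * c W) *
          (∑ W ∈ U.powerset, ν W * chainMix ∅ ent' 1 c d' W * (x W * y W))
        - (∑ W ∈ U.powerset, ν W * chainMix ∅ ent' 1 c d W) *
          (∑ W ∈ U.powerset, ν W * c W * y W) *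
          (∑ W ∈ U.powerset, ν W * chainMix ∅ ent' 1 c d' W * x W)
        - (∑ W ∈ U.powerset, ν W * c W) *
          (∑ W ∈ U.powerset, ν W * chainMix ∅ ent' 1 c d W * x W) *
          (∑ W ∈ U.powerset, ν W * chainMix ∅ ent' 1 c d' W * y W)
        + (∑ W ∈ U.powerset, ν W * chainMix ∅ ent' 1 c d W * x W) *
          (∑ W ∈ U.powerset, ν W * c W * y W) *
          (∑ W ∈ U.powerset, ν W * chainMix ∅ ent' 1 c d' W))
        + ((∑ W ∈ U.powerset, ν W * c W) *
          (∑ W ∈ U.powerset, ν W * chainMix ∅ ent' 1 c d W) *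
          (∑ W ∈ U.powerset, ν W * chainMix ∅ ent' 1 c d' W * (x W * y W))
        - (∑ W ∈ U.powerset, ν W * c W) *
          (∑ W ∈ U.powerset, ν W * chainMix ∅ ent' 1 c d W * y W) *
          (∑ W ∈ U.powerset, ν W * chainMix ∅ ent' 1 c d' W * x W)
        - (∑ W ∈ U.powerset, ν W * chainMix ∅ ent' 1 c d W) *
          (∑ W ∈ U.powerset, ν W * c W * x W) *
          (∑ W ∈ U.powerset, ν W * chainMix ∅ ent' 1 c d' W * y W)
        + (∑ W ∈ U.powerset, ν W * c W * x W) *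
          (∑ W ∈ U.powerset, ν W * chainMix ∅ ent' 1 c d W * y W) *
          (∑ W ∈ U.powerset, ν W * chainMix ∅ ent' 1 c d' W))) :
    0 ≤ (∑ W ∈ U.powerset, ν W * chainMix ∅ ent' ρ c d W) ^ 2 *
          (∑ W ∈ U.powerset, ν W * chainMix ∅ ent' ρ c d' W * (x W * y W))
        - (∑ W ∈ U.powerset, ν W * chainMix ∅ ent' ρ c d W) *
          (∑ W ∈ U.powerset, ν W * chainMix ∅ ent' ρ c d W * x W) *
          (∑ W ∈ U.powerset, ν W * chainMix ∅ ent' ρ c d' W * y W)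
        - (∑ W ∈ U.powerset, ν W * chainMix ∅ ent' ρ c d W) *
          (∑ W ∈ U.powerset, ν W * chainMix ∅ ent' ρ c d W * y W) *
          (∑ W ∈ U.powerset, ν W * chainMix ∅ ent' ρ c d' W * x W)
        + (∑ W ∈ U.powerset, ν W * chainMix ∅ ent' ρ c d W * x W) *
          (∑ W ∈ U.powerset, ν W * chainMix ∅ ent' ρ c d W * y W) *
          (∑ W ∈ U.powerset, ν W * chainMix ∅ ent' ρ c d' W) := by
  -- the seven sums at `ρ` are affine in `ρ`
  have hR : ∀ W, ν W * chainMix ∅ ent' ρ c d W =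
      (1 - ρ) * (ν W * c W) + ρ * (ν W * chainMix ∅ ent' 1 c d W) := by
    intro W; rw [chainMix_affine ∅ ent' ρ c d W, chainMix_zero_empty ent' c d W]; ring
  have hG : ∀ W, ν W * chainMix ∅ ent' ρ c d' W =
      (1 - ρ) * (ν W * c W) + ρ * (ν W * chainMix ∅ ent' 1 c d' W) := by
    intro W; rw [chainMix_affine ∅ ent' ρ c d' W, chainMix_zero_empty ent' c d' W]; ring
  have s0 : ∑ W ∈ U.powerset, ν W * chainMix ∅ ent' ρ c d W =
      (1 - ρ) * ∑ W ∈ U.powerset, ν W * c W +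
        ρ * ∑ W ∈ U.powerset, ν W * chainMix ∅ ent' 1 c d W := by
    rw [Finset.mul_sum, Finset.mul_sum, ← Finset.sum_add_distrib]
    exact Finset.sum_congr rfl fun W _ => hR W
  have s1 : ∑ W ∈ U.powerset, ν W * chainMix ∅ ent' ρ c d W * x W =
      (1 - ρ) * ∑ W ∈ U.powerset, ν W * c W * x W +
        ρ * ∑ W ∈ U.powerset, ν W * chainMix ∅ ent' 1 c d W * x W := by
    rw [Finset.mul_sum, Finset.mul_sum, ← Finset.sum_add_distrib]
    exact Finset.sum_congr rfl fun W _ => by rw [hR W]; ring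
  have s2 : ∑ W ∈ U.powerset, ν W * chainMix ∅ ent' ρ c d W * y W =
      (1 - ρ) * ∑ W ∈ U.powerset, ν W * c W * y W +
        ρ * ∑ W ∈ U.powerset, ν W * chainMix ∅ ent' 1 c d W * y W := by
    rw [Finset.mul_sum, Finset.mul_sum, ← Finset.sum_add_distrib]
    exact Finset.sum_congr rfl fun W _ => by rw [hR W]; ring
  have g0 : ∑ W ∈ U.powerset, ν W * chainMix ∅ ent' ρ c d' W =
      (1 - ρ) * ∑ W ∈ U.powerset, ν W * c W +
        ρ * ∑ W ∈ U.powerset, ν W * chainMix ∅ ent' 1 c d' W := by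
    rw [Finset.mul_sum, Finset.mul_sum, ← Finset.sum_add_distrib]
    exact Finset.sum_congr rfl fun W _ => hG W
  have g1 : ∑ W ∈ U.powerset, ν W * chainMix ∅ ent' ρ c d' W * x W =
      (1 - ρ) * ∑ W ∈ U.powerset, ν W * c W * x W +
        ρ * ∑ W ∈ U.powerset, ν W * chainMix ∅ ent' 1 c d' W * x W := by
    rw [Finset.mul_sum, Finset.mul_sum, ← Finset.sum_add_distrib]
    exact Finset.sum_congr rfl fun W _ => by rw [hG W]; ring
  have g2 : ∑ W ∈ U.powerset, ν W * chainMix ∅ ent' ρ c d' W * y W =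
      (1 - ρ) * ∑ W ∈ U.powerset, ν W * c W * y W +
        ρ * ∑ W ∈ U.powerset, ν W * chainMix ∅ ent' 1 c d' W * y W := by
    rw [Finset.mul_sum, Finset.mul_sum, ← Finset.sum_add_distrib]
    exact Finset.sum_congr rfl fun W _ => by rw [hG W]; ring
  have g12 : ∑ W ∈ U.powerset, ν W * chainMix ∅ ent' ρ c d' W * (x W * y W) =
      (1 - ρ) * ∑ W ∈ U.powerset, ν W * c W * (x W * y W) +
        ρ * ∑ W ∈ U.powerset, ν W * chainMix ∅ ent' 1 c d' W * (x W * y W) := by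
    rw [Finset.mul_sum, Finset.mul_sum, ← Finset.sum_add_distrib]
    exact Finset.sum_congr rfl fun W _ => by rw [hG W]; ring
  rw [s0, s1, s2, g0, g1, g2, g12]
  -- FKG of the world-0 law `ν·c`
  have hL₀0 : ∀ W, 0 ≤ ν W * c W := fun W => mul_nonneg (hν0 W) (hc0 W)
  have hD : (∑ W ∈ U.powerset, ν W * c W * x W) * (∑ W ∈ U.powerset, ν W * c W * y W) ≤
      (∑ W ∈ U.powerset, ν W * c W) * (∑ W ∈ U.powerset, ν W * c W * (x W * y W)) := by
    refine ad_pointwise U (fun W => ν W * c W * x W) (fun W => ν W * c W * y W)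
      (fun W => ν W * c W) (fun W => ν W * c W * (x W * y W))
      (fun W => mul_nonneg (hL₀0 W) (hx0 W)) (fun W => mul_nonneg (hL₀0 W) (hy0 W)) hL₀0
      (fun W => mul_nonneg (hL₀0 W) (mul_nonneg (hx0 W) (hy0 W))) ?_
    intro s hs t ht
    have e1 : ν s * ν t ≤ ν (s ∩ t) * ν (s ∪ t) := hν s hs t ht
    have e2 := hcc s t
    have e3 := hxm s t
    have e4 : y t ≤ y (s ∪ t) := by rw [Finset.union_comm]; exact hym t s
    calc ν s * c s * x s * (ν t * c t * y t)
        = (ν s * ν t) * (c s * c t) * (x s * y t) := by ring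
      _ ≤ (ν (s ∩ t) * ν (s ∪ t)) * (c (s ∩ t) * c (s ∪ t)) * (x (s ∪ t) * y (s ∪ t)) := by
          apply mul_le_mul (mul_le_mul e1 e2 (mul_nonneg (hc0 _) (hc0 _))
            (mul_nonneg (hν0 _) (hν0 _)))
            (mul_le_mul e3 e4 (hy0 _) (hx0 _)) (mul_nonneg (hx0 _) (hy0 _))
            (mul_nonneg (mul_nonneg (hν0 _) (hν0 _)) (mul_nonneg (hc0 _) (hc0 _)))
      _ = ν (s ∩ t) * c (s ∩ t) * (ν (s ∪ t) * c (s ∪ t) * (x (s ∪ t) * y (s ∪ t))) := by ring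
  have ha0 : 0 ≤ ∑ W ∈ U.powerset, ν W * c W := Finset.sum_nonneg fun W _ => hL₀0 W
  have hb0 : 0 ≤ ∑ W ∈ U.powerset, ν W * chainMix ∅ ent' 1 c d W :=
    Finset.sum_nonneg fun W _ =>
      mul_nonneg (hν0 W) (chainMix_nonneg ∅ ent' zero_le_one le_rfl hc0 hd0 W)
  -- the kernel mixed-centre terms
  have hU111 := chain_world1_mixed_nonneg U ∅ ent' ν c d d' 1 1 zero_le_one le_rfl zero_le_one
    le_rfl hν0 hν hc0 hd0 hd'0 hdc hd'c hcc hdd hd'd' hcd hcd' hdd' hratio hratio' x y hx0 hy0 hxm hym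
  have hU001 := chain_world1_mixed_nonneg U ∅ ent' ν c d d' 0 0 le_rfl zero_le_one le_rfl
    zero_le_one hν0 hν hc0 hd0 hd'0 hdc hd'c hcc hdd hd'd' hcd hcd' hdd' hratio hratio' x y hx0 hy0 hxm hym
  simp only [chainMix_zero_empty] at hU001
  refine chain_bernstein_nonneg _ _ _ _ _ _ _ _ _ _ _ _ _ _ ρ hρ0 hρ1 ?_ ?_ hb2 hU111
  · nlinarith [mul_nonneg ha0 (sub_nonneg.mpr hD)]
  · nlinarith [mul_nonneg hb0 (sub_nonneg.mpr hD)]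

end QstarChain


end Summit.Ventures.PercRepro2.Coin
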